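import Summits.QuantumAdvantage.QuantumAdvantage.Theses.LinnikCubicClassGroups
import Summits.QuantumAdvantage.QuantumAdvantage.Theorems.LinnikCubicClassGroupsPureCubicClassGroupFBQPStubClassStageAssemblyTable
import Summits.QuantumAdvantage.QuantumAdvantage.Theorems.LinnikCubicClassGroupsPureCubicClassGroupFBQPStubClassStageAssemblyProb
import Summits.QuantumAdvantage.QuantumAdvantage.Theorems.LinnikCubicClassGroupsPureCubicClassGroupFBQPStubClassStageParamsIneq
import Summits.QuantumAdvantage.QuantumAdvantage.Theorems.LinnikCubicClassGroupsPureCubicClassGroupFBQPStubClassStageSSParams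
import Summits.QuantumAdvantage.QuantumAdvantage.Theorems.LinnikCubicClassGroupsPureCubicClassGroupFBQPStubClassStageQry
import Summits.QuantumAdvantage.QuantumAdvantage.Theorems.LinnikCubicClassGroupsPureCubicClassGroupFBQPStubClassStageTab
import Summits.QuantumAdvantage.QuantumAdvantage.Theorems.LinnikCubicClassGroupsPureCubicClassGroupFBQPStubClassStagePre
import Summits.QuantumAdvantage.QuantumAdvantage.Theorems.LinnikCubicClassGroupsPureCubicClassGroupFBQPStubClassStagePost
import Summits.QuantumAdvantage.QuantumAdvantage.Theorems.LinnikCubicClassGroupsPureCubicClassGroupFBQPStubClassStageFormat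
import Summits.QuantumAdvantage.QuantumAdvantage.Theorems.LinnikCubicClassGroupsPureCubicClassGroupFBQPStubCubicFieldFacts
import Summits.QuantumAdvantage.QuantumAdvantage.Theorems.LinnikCubicClassGroupsPureCubicClassGroupFBQPStubCoreOrderCanonical
import Summits.QuantumAdvantage.QuantumAdvantage.Theorems.LinnikCubicClassGroupsPureCubicClassGroupFBQPStubAdmissibleFields
import Summits.QuantumAdvantage.QuantumAdvantage.Theorems.LinnikCubicClassGroupsPureCubicClassGroupFBQPStubCubicReduction
import Literature.Computability.Cryptography.ShiftSamplingCharVector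
import Literature.Computability.Cryptography.HallgrenPellQuantum
import Literature.NumberTheory.NumberFields.PureCubicDiscriminantBound
import Literature.NumberTheory.NumberFields.PureCubicEmbeddings
import Literature.Computability.Complexity.AlgebraicQueryRectangles

/-!
# Crux `LinnikCubicClassGroups.PureCubicClassGroupFBQP` (stmt-QuantumAdvantage-11544) — the class-group stage assembled (`ClassStageMain`)

Line `arakelov-giant-step-cycle`, stub `stub_classStageAssembly` (S5b-ASM), main file: from the five parts (G2, P5a, P5b, P6,
P7) the success statement `CubicClassStage.ClassStageMain` of the class-group stage given correct regulator advice: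

1. programs: the table bundle and the order code (`classStage_table`), the shift-sampling bundle `P` (`classStage_ssParams`:
   `1600 (n+4)²` units, accuracy `2^-19/(n+4)²`), the table as a string program and the quantum family reading all unit
   characters (`classStage_tab`, `ShiftSampling.charVector_family`), the query, the padded input and the post-processor
   (`classStage_qry`, `classStage_pre`, `classStage_post`);
2. on a well-formed input `w = ⟨x, ⟨⟨f,a,b⟩, ps⟩⟩` with good advice `r`: an admissible field `K ∋ α`, `α³ = m = f³ab²`, carries
   `θ = α/f` with `θ³ = ab²`; the parameter inequalities (`classStage_params`, sizes read off the input format); the structural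
   interface of the table (`classStage_table` at `K`) at the explicit parameters gives the hidden lattice `Λ` of index the
   subgroup order and the `ShiftCellCosetTable`; the family's input is `z = pre ⟨w, bin r⟩` of length exactly `Z |w|`;
3. `ps = []`: the post-processor answers `1 = |⊥|` and every run succeeds; `ps ≠ []`: `classStage_prob` (P6 ∘ P7) bounds the
   weight of the character vectors that post-process to `[ℤ^T : Λ]` by `1 − 1/32`, `charVector_family` turns it into a
   kernel probability `≥ (1 − 1600/2^19)(1 − 1/32) ≥ 11/12` of an event on which `post` outputs `bin [ℤ^T : Λ]`, which is
   the subgroup order in EVERY admissible field (`stub_coreOrderCanonical`).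
-/

-- the problem namespace repeats the summit name (`QuantumAdvantage.QuantumAdvantage`)
set_option linter.dupNamespace false

namespace Summit.QuantumAdvantage.QuantumAdvantage.Theorems.LinnikCubicClassGroups

open Finset
open Computability (encodeNat decodeNat decode_encodeNat)
open Literature.Computability.Complexity (boolPair boolUnpair boolUnpair_boolPair length_boolPair CodeFP FP
  encodingListNatBool decodeNat_lt_two_pow_succ)
open Literature.Computability.Complexity.CodeFP (pairE strE natE intE bitE unE rawE pairE_injective natE_injective
  rawE_injective intE_injective length_natE)
open Literature.Computability.Cryptography (QCircuitFamily cliffordT CubicClassTable.WalkFns)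
open Literature.Computability.Cryptography.HallgrenQuantum (kernelProb_mono)
open Literature.Computability.Cryptography.PeriodFinding (corrMass ηacc prob_univ unitLaw_isProbVec)
open Literature.Computability.Cryptography.ShiftSampling (charVector_family)
open Literature.Computability.Cryptography.CubicClassSampling (ClaimLexMin ClaimTableFP ClaimTableSem ClaimSamplingLaw
  ClaimPost ClassTableInterfaceQ3 ShiftCellCosetTable TableArgs tableArgsE instOfArgs)
open Literature.Computability.Cryptography.CubicClassStage (ClassStageMain ClassStageGoal)
open Literature.Computability.Cryptography.CubicClassStageParams
open Literature.Computability.Cryptography.CubicClassPost (PostParams)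
open Literature.NumberTheory.NumberFields.PureCubic (abs_discr_le)
open scoped NumberField nonZeroDivisors

/-! ### Sizes read off the input format -/

/-- A list is at most as long as its code. -/
theorem length_le_length_encode_list (l : List ℕ) : l.length ≤ (encodingListNatBool.encode l).length := by
  show l.length ≤ (boolPair (Computability.unaryEncodeNat l.length) _).length
  rw [length_boolPair]
  have : (Computability.unaryEncodeNat l.length).length = l.length := by
    induction l.length with
    | zero => rfl
    | succ k ih => simp [Computability.unaryEncodeNat, ih]
  omega

/-- A member of a list is shorter (in binary) than the code of the list. -/
theorem size_le_length_encode_of_mem {l : List ℕ} {p : ℕ} (hp : p ∈ l) :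
    (encodeNat p).length ≤ (encodingListNatBool.encode l).length := by
  show (encodeNat p).length ≤ (boolPair (Computability.unaryEncodeNat l.length)
    (l.foldr (fun a acc => boolPair (Computability.encodingNatBool.encode a) acc) [])).length
  rw [length_boolPair]
  suffices h : (encodeNat p).length ≤ (l.foldr (fun a acc => boolPair (Computability.encodingNatBool.encode a) acc) []).length by
    omega
  induction l with
  | nil => simp at hp
  | cons a l ih =>
    rw [List.foldr_cons, length_boolPair]
    rcases List.mem_cons.mp hp with rfl | h
    · show (encodeNat p).length ≤ 2 * (encodeNat p).length + 2 + _
      omega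
    · have := ih h
      omega

/-- `n < 2 ^ (encodeNat n).length.succ` … precisely `n < 2 ^ size n ≤ 2 ^ L` whenever `size n ≤ L`. -/
theorem lt_two_pow_of_size_le {m L : ℕ} (h : (encodeNat m).length ≤ L) : m < 2 ^ (L + 1) := by
  have hs : Nat.size m ≤ L := by rwa [show encodeNat m = natE m from rfl, length_natE] at h
  calc m < 2 ^ Nat.size m := Nat.lt_size_self m
    _ ≤ 2 ^ L := Nat.pow_le_pow_right (by norm_num) hs
    _ ≤ 2 ^ (L + 1) := Nat.pow_le_pow_right (by norm_num) (Nat.le_succ L)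

/-- The components of a well-formed input are determined by it. -/
theorem input_inj {x x' : List Bool} {f a b f' a' b' : ℕ} {ps ps' : List ℕ}
    (h : boolPair x (boolPair (boolPair (encodeNat f) (boolPair (encodeNat a) (encodeNat b))) (encodingListNatBool.encode ps)) =
      boolPair x' (boolPair (boolPair (encodeNat f') (boolPair (encodeNat a') (encodeNat b')))
        (encodingListNatBool.encode ps'))) :
    x = x' ∧ f = f' ∧ a = a' ∧ b = b' ∧ ps = ps' := by
  have bp : ∀ {u v u' v' : List Bool}, boolPair u v = boolPair u' v' → u = u' ∧ v = v' := fun e => by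
    have h1 := congrArg boolUnpair e
    rwa [boolUnpair_boolPair, boolUnpair_boolPair, Prod.mk.injEq] at h1
  have en : ∀ {m n : ℕ}, encodeNat m = encodeNat n → m = n := fun e => by
    have h1 := congrArg decodeNat e
    rwa [decode_encodeNat, decode_encodeNat] at h1
  obtain ⟨hx, h2⟩ := bp h
  obtain ⟨h3, hps⟩ := bp h2
  obtain ⟨hf, h4⟩ := bp h3
  obtain ⟨ha, hb⟩ := bp h4
  refine ⟨hx, en hf, en ha, en hb, ?_⟩
  have := congrArg encodingListNatBool.decode hps
  rwa [encodingListNatBool.decode_encode, encodingListNatBool.decode_encode, Option.some.injEq] at this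

/-! ### The subgroup of no primes -/

/-- With no primes handed, the generated subgroup is trivial and has one element. -/
theorem card_closure_nil (K : Type) [Field K] [NumberField K] :
    Nat.card (Subgroup.closure {c : ClassGroup (𝓞 K) | ∃ p ∈ ([] : List ℕ), ∃ P : Ideal (𝓞 K),
      ∃ hP : P ∈ nonZeroDivisors (Ideal (𝓞 K)), P.IsPrime ∧ Ideal.absNorm P = p ∧ c = ClassGroup.mk0 ⟨P, hP⟩}) = 1 := by
  have : {c : ClassGroup (𝓞 K) | ∃ p ∈ ([] : List ℕ), ∃ P : Ideal (𝓞 K),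
      ∃ hP : P ∈ nonZeroDivisors (Ideal (𝓞 K)), P.IsPrime ∧ Ideal.absNorm P = p ∧ c = ClassGroup.mk0 ⟨P, hP⟩} = ∅ := by
    ext c; simp
  rw [this, Subgroup.closure_empty, Subgroup.card_bot]

/-! ### Arithmetic on plain variables -/

/-- The final success bound on plain variables. -/
theorem final_arith {p s t : ℝ} (ht : t ≤ 1 / 64) (hs : 1 - (1 : ℝ) / 32 ≤ s) (h : (1 - t) * s ≤ p) : (11 : ℝ) / 12 ≤ p := by
  nlinarith

/-- Reindexing the character-vector sum along equal sizes (the sizes are huge closed terms: `subst` on variables). -/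
theorem sum_charVec_congr (Pp : PostParams) (idx Lq : ℕ) (F : ℕ → List Bool) {N N' M M' : ℕ} (hN : N = N')
    (hM : M = M') :
    (∑ cs : Fin N → Fin M, if Pp.postOutC (List.ofFn fun u => ((cs u : ℕ))) = idx then
        ∏ u, corrMass (2 ^ Lq) F ((cs u : ℕ) : ℤ) / ((2 : ℝ) ^ Lq) ^ 2 else 0) =
      ∑ cs : Fin N' → Fin M', if Pp.postOutC (List.ofFn fun u => ((cs u : ℕ))) = idx then
        ∏ u, corrMass (2 ^ Lq) F ((cs u : ℕ) : ℤ) / ((2 : ℝ) ^ Lq) ^ 2 else 0 := by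
  subst hN; subst hM; rfl

/-- `(range N).map g` as a `List.ofFn`. -/
theorem map_range_eq_ofFn (N : ℕ) (g : ℕ → ℕ) : (List.range N).map g = List.ofFn fun u : Fin N => g u := by
  rw [List.ofFn_eq_map, ← List.map_coe_finRange_eq_range, List.map_map]; rfl

/-! ### The main theorem -/

-- this linter exhausts the recursion depth on the read-out type of the sampling family (as on `kernelProb_ge_gen`)
set_option linter.constructorNameAsVariable false in
/-- **S5b-ASM `classStage_main`**: the class-group stage succeeds (`ClassStageMain`) given the five parts. -/
theorem classStage_main :
    ClaimLexMin → ClaimTableFP → ClaimTableSem → ClaimSamplingLaw → ClaimPost → ClassStageMain := by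
  intro hLex hFP hSem hLaw hPost
  classical
  -- ### the programs
  obtain ⟨ordL, Fw, hordL, hTabFP, hQ3⟩ := classStage_table hLex hFP hSem
  obtain ⟨P, Γ, hnU, hL, hLv, hBrep, cnU, cL, cLv, cB, hη⟩ := classStage_ssParams
  have hLvL : ∀ n, P.Lv n = P.L n + 1 := fun n => by rw [hLv, hL]
  obtain ⟨tab, htab, htabv⟩ := classStage_tab Fw hTabFP
  obtain ⟨hUnif, ⟨rd, hrd, hrdv⟩, hfam⟩ := charVector_family P Γ cnU cL cLv cB hLvL tab htab
  obtain ⟨qry, hqry, hqryv⟩ := classStage_qry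
  obtain ⟨pre, hpre, hprev⟩ := classStage_pre ordL hordL
  obtain ⟨post, hpost, hpostv⟩ := classStage_post P rd pre hrd hpre cnU cL hrdv hFP.2
  refine ⟨qry, hqry, ?_, pre, post, hpre, hpost, P.family (P.blockFn_mem_FP cnU cL cLv cB htab),
    P.family_isOracleFree _, hUnif, ?_⟩
  · -- well-formed inputs give well-formed queries
    rintro w ⟨x, f, a, b, ps, hw, hdec, hsq, hnc, -⟩
    exact ⟨x, f, a, b, kOf w.length a b ps, hqryv x f a b ps w hw, hdec, hsq, hnc⟩
  -- ### one input with good advice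
  intro w r hWF hgood
  obtain ⟨x, f, a, b, ps, hw, hdec, hsq, hnc, hps⟩ := hWF
  set n := w.length with hn
  -- elementary facts about the data
  have hf0 : f ≠ 0 := by
    rintro rfl
    exact hnc 0 (by rw [hdec]; ring)
  have ha0 : a ≠ 0 := fun h => by rw [h, zero_mul] at hsq; exact not_squarefree_zero hsq
  have hb0 : b ≠ 0 := fun h => by rw [h, mul_zero] at hsq; exact not_squarefree_zero hsq
  have hab1 : a * b ≠ 1 := by
    intro h
    have ha1 : a = 1 := Nat.eq_one_of_mul_eq_one_right h
    have hb1 : b = 1 := Nat.eq_one_of_mul_eq_one_left h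
    exact hnc f (by rw [hdec, ha1, hb1]; ring)
  have hm1 : 1 ≤ decodeNat x := by
    rw [hdec]; exact Nat.one_le_iff_ne_zero.mpr (by positivity)
  -- sizes read off the input format
  have hlenw : n = 2 * x.length + 2 + (2 * (2 * (encodeNat f).length + 2 + (2 * (encodeNat a).length + 2 +
      (encodeNat b).length)) + 2 + (encodingListNatBool.encode ps).length) := by
    rw [hn, hw]; simp only [length_boolPair]
  have hxa : a < 2 ^ (n + 1) := lt_two_pow_of_size_le (by omega)
  have hxb : b < 2 ^ (n + 1) := lt_two_pow_of_size_le (by omega)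
  have hxm : decodeNat x < 2 ^ (n + 1) :=
    lt_of_lt_of_le (decodeNat_lt_two_pow_succ x) (Nat.pow_le_pow_right (by norm_num) (by omega))
  have hxps : ps.length ≤ n := (length_le_length_encode_list ps).trans (by omega)
  have hxp : ∀ p ∈ ps, p < 2 ^ (n + 1) := fun p hp =>
    lt_two_pow_of_size_le ((size_le_length_encode_of_mem hp).trans (by omega))
  have hpar := classStage_params n a b (decodeNat x) ps (Nat.one_le_iff_ne_zero.mpr ha0) (Nat.one_le_iff_ne_zero.mpr hb0) hxa hxb
    hm1 hxm hxps hxp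
  -- ### an admissible field and `θ = α / f`
  obtain ⟨⟨K, iF, iN, hdeg, α, hα⟩, hfacts⟩ := stub_cubicFieldFacts (decodeNat x) hnc
  have hfK : (f : K) ≠ 0 := Nat.cast_ne_zero.mpr hf0
  set θ : K := α / f with hθdef
  have hθ : θ ^ 3 = ((a * b ^ 2 : ℕ) : K) := by
    rw [hθdef, div_pow, hα, hdec]
    push_cast
    field_simp
  -- the advice is good for `K`
  have hadv : |(r : ℝ) - 2 ^ kOf n a b ps * NumberField.Units.regulator K| ≤ 1 :=
    hgood x f a b (kOf n a b ps) (hqryv x f a b ps w hw) hdec hsq K hdeg hnc ⟨α, hα⟩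
  -- ### the structural interface of the table at `K`
  obtain ⟨⟨hord1, hord6, hord3⟩, hI⟩ := hQ3 a b hsq hab1 K hdeg θ hθ
  have hprimes : ∀ p ∈ ps, p.Prime ∧ ¬ p ∣ 3 * (a * b ^ 2) := fun p hp => by
    refine ⟨(hps p hp).1, fun h => (hps p hp).2 (dvd_trans h ?_)⟩
    rw [hdec]; exact ⟨f ^ 3, by ring⟩
  have hpar' := hpar
  obtain ⟨h20, hlk, hlayout, hs50, hcap1, hcap2, h1B, hBlt, heps, hle, hstail, hK0a, hK0b, hround, hbud1, hbud2, hkit⟩ :=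
    hpar
  obtain ⟨Λ, hΛfin, F₀, cls, σ, C, y, μ, Badκ, D, hidx, hSC⟩ := hI (a * b ^ 2) ps r (kOf n a b ps) hprimes rfl hadv
    (leOf n a b ps) 0 (sOf n a b) (lkOf n a b ps) (lbOf n a b ps) (precOf n a b ps) (sOf n a b) (18 * KN a b)
    (6 * LD a b + 16) 0 (32 * KN a b ^ 2) 0 (capOf a b ps) (2 * e6 n) h20
    (by show _ ≤ leOf n a b ps + sOf n a b + 60 + 6 * LD a b + 2 * e6 n + 2 * Nat.size ps.length; unfold LD; omega)
    (by show _ ≤ kOf n a b ps + sOf n a b + 64; omega) (by unfold LD at hs50; omega) le_rfl rfl (le_of_eq rfl) rfl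
    (le_of_eq rfl) hcap1 hcap2 rfl (le_of_eq rfl)
  -- the subgroup order is at most the class-number bound
  have hidxB : Λ.index ≤ hB (decodeNat x) := by
    rw [hidx]
    obtain ⟨-, -, hh, -⟩ := hfacts K hdeg ⟨α, hα⟩
    refine le_trans ?_ hh
    refine le_trans (Subgroup.card_le_card_group _) (le_of_eq ?_)
    rw [Nat.card_eq_fintype_card]; rfl
  -- ### the family's input `z = pre ⟨w, bin r⟩`, of length exactly `Z n`
  obtain ⟨pad, hzeq, hzlen⟩ := hprev x f a b ps r w hw
  -- the advice is small: `r ≤ 2^k R + 1 ≤ 2^(k + 6 LD) + 1`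
  have hrle : r ≤ 2 ^ (kOf n a b ps + 6 * LD a b + 2) := by
    obtain ⟨σ₁, σ₂, hσ₂⟩ := Literature.NumberTheory.NumberFields.PureCubic.exists_embeddings_pair hdeg hsq hab1 hθ
    have hR : NumberField.Units.regulator K ≤ |(NumberField.discr K : ℝ)| ^ 6 :=
      (stub_cubicReduction K hdeg σ₁ σ₂ hσ₂).2.2.2
    have hd : |(NumberField.discr K : ℝ)| ≤ 27 * (a : ℝ) ^ 2 * (b : ℝ) ^ 2 := by
      have h := abs_discr_le hdeg hsq hab1 hθ
      have h' : ((|NumberField.discr K| : ℤ) : ℝ) ≤ ((27 * (a : ℤ) ^ 2 * (b : ℤ) ^ 2 : ℤ) : ℝ) := by exact_mod_cast h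
      simpa [Int.cast_abs] using h'
    have hD : (27 * (a : ℝ) ^ 2 * (b : ℝ) ^ 2) < 2 ^ LD a b := by
      have := Nat.lt_size_self (27 * a ^ 2 * b ^ 2)
      unfold LD
      exact_mod_cast this
    have hR' : NumberField.Units.regulator K ≤ 2 ^ (6 * LD a b) := by
      calc NumberField.Units.regulator K ≤ |(NumberField.discr K : ℝ)| ^ 6 := hR
        _ ≤ (2 ^ LD a b) ^ 6 := by gcongr; exact hd.trans hD.le
        _ = 2 ^ (6 * LD a b) := by rw [← pow_mul, mul_comm]
    have h1 : (r : ℝ) ≤ 2 ^ kOf n a b ps * NumberField.Units.regulator K + 1 := by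
      have := (abs_le.mp hadv).2; linarith
    have h2 : (r : ℝ) ≤ 2 ^ (kOf n a b ps + 6 * LD a b) + 1 := by
      calc (r : ℝ) ≤ 2 ^ kOf n a b ps * NumberField.Units.regulator K + 1 := h1
        _ ≤ 2 ^ kOf n a b ps * 2 ^ (6 * LD a b) + 1 := by gcongr
        _ = 2 ^ (kOf n a b ps + 6 * LD a b) + 1 := by rw [pow_add]
    have h3 : r ≤ 2 ^ (kOf n a b ps + 6 * LD a b) + 1 := by exact_mod_cast h2
    calc r ≤ 2 ^ (kOf n a b ps + 6 * LD a b) + 1 := h3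
      _ ≤ 2 ^ (kOf n a b ps + 6 * LD a b + 2) := by
        rw [pow_succ, pow_succ]
        have : 1 ≤ 2 ^ (kOf n a b ps + 6 * LD a b) := Nat.one_le_two_pow
        omega
  have hz : (pre (boolPair w (encodeNat r))).length = Z n := by rw [hzeq]; exact hzlen hord1 hord6 hord3 hrle
  have hLz : topOf n a b ps + sOf n a b + leOf n a b ps * Tp ps = P.L (pre (boolPair w (encodeNat r))).length := by
    rw [hL, hz, hlayout]
  -- the table the family reads is the coded class table at `theInst`
  set code : (ℕ × List ℤ) × ℕ → List Bool := pairE (pairE natE (rawE intE)) natE with hcodedef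
  have hcode : Function.Injective code :=
    pairE_injective (pairE_injective natE_injective (rawE_injective intE_injective)) natE_injective
  set Fv : ℕ → (ℕ × List ℤ) × ℕ := Fw.classTableOpQ (theInst n a b ps (ordL (a, b)) r) (capOf a b ps) with hFvdef
  have htabz : tab (pre (boolPair w (encodeNat r))) = code ∘ Fv := by
    funext v
    rw [hzeq, htabv]
    rfl
  -- ### the post-processor on this input
  by_cases hps0 : ps = []
  · -- no primes: the answer is `1 = |⊥|` on EVERY run
    have hall : ∀ y, post (boolPair (boolPair w (encodeNat r)) y) = encodeNat 1 := fun y => by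
      rw [hpostv x f a b ps r w y hw hLz, if_pos hps0]
    have huniv : (P.family (P.blockFn_mem_FP cnU cL cLv cB htab)).kernelProb 0 (pre (boolPair w (encodeNat r))) Set.univ = 1 := by
      have hk := P.kernelProb_family (P.blockFn_mem_FP cnU cL cLv cB htab) (pre (boolPair w (encodeNat r))) Finset.univ
      have hset : {v : List Bool | P.readOf (pre (boolPair w (encodeNat r))).length v ∈
          (Finset.univ : Finset (P.Readout (pre (boolPair w (encodeNat r))).length))} = Set.univ := by
        ext v; simp
      rw [hset] at hk
      rw [hk, prob_univ (unitLaw_isProbVec _ _)]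
    have hsub : (Set.univ : Set (List Bool)) ⊆ {y | ∀ (x' : List Bool) (f' a' b' : ℕ) (ps' : List ℕ),
        w = boolPair x' (boolPair (boolPair (encodeNat f') (boolPair (encodeNat a') (encodeNat b')))
          (encodingListNatBool.encode ps')) → decodeNat x' = f' ^ 3 * (a' * b' ^ 2) → Squarefree (a' * b') →
        ∀ (K' : Type) [Field K'] [NumberField K'], Module.finrank ℚ K' = 3 →
          (∀ r : ℕ, r ^ 3 ≠ decodeNat x') → (∃ α : K', α ^ 3 = (decodeNat x' : K')) →
          (∀ p ∈ ps', p.Prime ∧ ¬ p ∣ 3 * decodeNat x') →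
          post (boolPair (boolPair w (encodeNat r)) y) = encodeNat (Nat.card (Subgroup.closure
            {c : ClassGroup (𝓞 K') | ∃ p ∈ ps', ∃ P : Ideal (𝓞 K'), ∃ hP : P ∈ nonZeroDivisors (Ideal (𝓞 K')),
              P.IsPrime ∧ Ideal.absNorm P = p ∧ c = ClassGroup.mk0 ⟨P, hP⟩}))} := by
      intro y _ x' f' a' b' ps' hw' _ _ K' _ _ _ _ _ _
      obtain ⟨-, -, -, -, rfl⟩ := input_inj (hw.symm.trans hw')
      rw [hall y, hps0, card_closure_nil K']
    have hmono := kernelProb_mono (A := 0) (P.family (P.blockFn_mem_FP cnU cL cLv cB htab)) (pre (boolPair w (encodeNat r))) hsub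
    rw [huniv] at hmono
    exact le_trans (by norm_num) hmono
  -- ### primes: the probability bound (P6 ∘ P7) and the character-vector family
  have hprobge := @classStage_prob hLaw hPost _ _ code hcode n a b (decodeNat x) ps hps0 hpar' Fv Λ hΛfin hidxB F₀ cls σ C
    y μ Badκ D hSC
  have hpostval : ∀ (yv : List Bool) (cs : Fin (P.nU (pre (boolPair w (encodeNat r))).length) →
      Fin (2 ^ P.L (pre (boolPair w (encodeNat r))).length)),
      (fun u : Fin (P.nU (pre (boolPair w (encodeNat r))).length) =>
        P.charOf (pre (boolPair w (encodeNat r))).length yv u) = (fun u => ((cs u : ℕ))) →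
      post (boolPair (boolPair w (encodeNat r)) yv) =
        encodeNat ((postP n a b (decodeNat x) ps).postOutC (List.ofFn fun u => ((cs u : ℕ)))) := by
    intro yv cs hcs
    rw [hpostv x f a b ps r w yv hw hLz, if_neg hps0, map_range_eq_ofFn]
    exact congrArg _ (congrArg _ (congrArg List.ofFn hcs))
  -- from here on `z` is the family's input
  set z := pre (boolPair w (encodeNat r)) with hzdef
  have hfam' := hfam z
  have hN : P.nU z.length = 2 * (800 * (Z n + 4) ^ 2) := by rw [hnU, hz]; ring
  have hM : P.L z.length = (postP n a b (decodeNat x) ps).Lq := by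
    show P.L z.length = topOf n a b ps + 0 + sOf n a b + leOf n a b ps * Tp ps
    omega
  have ht : (P.nU z.length : ℝ) * ηacc (P.Lv z.length) (P.B z.length) ≤ 1 / 64 := by
    rw [hη, hnU, hz]
    push_cast
    exact hkit
  generalize hNg : P.nU z.length = N at hfam' hpostval ht
  generalize hMg : P.L z.length = M at hfam' hpostval
  obtain rfl : N = 2 * (800 * (Z n + 4) ^ 2) := hNg.symm.trans hN
  obtain rfl : M = (postP n a b (decodeNat x) ps).Lq := hMg.symm.trans hM
  -- the success event of the post-processing, as a set of character vectors
  set G : Finset (Fin (2 * (800 * (Z n + 4) ^ 2)) → Fin (2 ^ (postP n a b (decodeNat x) ps).Lq)) :=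
    Finset.univ.filter fun cs => (postP n a b (decodeNat x) ps).postOutC (List.ofFn fun u => ((cs u : ℕ))) = Λ.index
    with hGdef
  have hG := hfam' G
  rw [htabz] at hG
  have hsumG : ∑ cs ∈ G, ∏ u, corrMass (2 ^ (postP n a b (decodeNat x) ps).Lq) (code ∘ Fv) ((cs u : ℕ) : ℤ) /
        ((2 : ℝ) ^ (postP n a b (decodeNat x) ps).Lq) ^ 2 =
      ∑ cs : Fin (2 * (800 * (Z n + 4) ^ 2)) → Fin (2 ^ (postP n a b (decodeNat x) ps).Lq),
        if (postP n a b (decodeNat x) ps).postOutC (List.ofFn fun u => ((cs u : ℕ))) = Λ.index then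
          ∏ u, corrMass (2 ^ (postP n a b (decodeNat x) ps).Lq) (code ∘ Fv) ((cs u : ℕ) : ℤ) /
            ((2 : ℝ) ^ (postP n a b (decodeNat x) ps).Lq) ^ 2
        else 0 := by
    rw [hGdef, Finset.sum_filter]
  rw [hsumG] at hG
  -- on the event the post-processor writes `bin [ℤ^T : Λ]`, the subgroup order in every admissible field
  have hsub : {v : List Bool | (fun u : Fin (2 * (800 * (Z n + 4) ^ 2)) => P.charOf z.length v u) ∈
        G.image (fun cs u => ((cs u : ℕ)))} ⊆
      {yv | ∀ (x' : List Bool) (f' a' b' : ℕ) (ps' : List ℕ),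
        w = boolPair x' (boolPair (boolPair (encodeNat f') (boolPair (encodeNat a') (encodeNat b')))
          (encodingListNatBool.encode ps')) → decodeNat x' = f' ^ 3 * (a' * b' ^ 2) → Squarefree (a' * b') →
        ∀ (K' : Type) [Field K'] [NumberField K'], Module.finrank ℚ K' = 3 →
          (∀ r : ℕ, r ^ 3 ≠ decodeNat x') → (∃ α : K', α ^ 3 = (decodeNat x' : K')) →
          (∀ p ∈ ps', p.Prime ∧ ¬ p ∣ 3 * decodeNat x') →
          post (boolPair (boolPair w (encodeNat r)) yv) = encodeNat (Nat.card (Subgroup.closure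
            {c : ClassGroup (𝓞 K') | ∃ p ∈ ps', ∃ P : Ideal (𝓞 K'), ∃ hP : P ∈ nonZeroDivisors (Ideal (𝓞 K')),
              P.IsPrime ∧ Ideal.absNorm P = p ∧ c = ClassGroup.mk0 ⟨P, hP⟩}))} := by
    intro yv hyv x' f' a' b' ps' hw' _ _ K' _ _ hdeg' _ hα' _
    obtain ⟨rfl, rfl, rfl, rfl, rfl⟩ := input_inj (hw.symm.trans hw')
    rw [Set.mem_setOf_eq, Finset.mem_image] at hyv
    obtain ⟨cs, hcs, hcsv⟩ := hyv
    rw [hpostval yv cs hcsv.symm]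
    have hcsG : (postP n a b (decodeNat x) ps).postOutC (List.ofFn fun u => ((cs u : ℕ))) = Λ.index := by
      rw [hGdef, Finset.mem_filter] at hcs; exact hcs.2
    rw [hcsG, hidx, stub_coreOrderCanonical stub_admissibleFields (decodeNat x) ps hnc K K' hdeg ⟨α, hα⟩ hdeg' hα']
  have hmono := kernelProb_mono (A := 0) (P.family (P.blockFn_mem_FP cnU cL cLv cB htab)) z hsub
  exact final_arith ht hprobge (le_trans hG hmono)

/-- **S5b-ASM `stub_classStageAssembly`** (the registered lead-held stub of line `arakelov-giant-step-cycle`): the five parts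
(cylinder-minimum program G2, table program P5a, table semantics P5b, sampling law P6, post-processing P7) give the goal of the
class-group stage — the success statement `classStage_main` together with the three format facts `classStage_incl1`,
`classStage_incl2`, `classStage_convex`. -/
theorem stub_classStageAssembly :
    ClaimLexMin → ClaimTableFP → ClaimTableSem → ClaimSamplingLaw → ClaimPost → ClassStageGoal :=
  fun hLex hFP hSem hLaw hPost =>
    ⟨classStage_main hLex hFP hSem hLaw hPost, classStage_incl1, classStage_incl2, classStage_convex⟩

end Summit.QuantumAdvantage.QuantumAdvantage.Theorems.LinnikCubicClassGroups
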